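import Summits.HodgeConjecture.HodgeConjecture.Theorems.Ring2AbelianAllSpreadFloorHeredity
import Summits.HodgeConjecture.HodgeConjecture.Theorems.Ring2AbelianAllSpreadFloorCollapse
import Literature.AlgebraicGeometry.HodgeTheory.HodgeTypeExteriorProduct
import HarnessLib

/-!
# Ring 2 · AbelianAll · SPREADING axis, part XXXII — `F_CM^mid` IS the floor at or above the middle, FACT-FREE:
# `F_CM^mid ⟹` the full instance of `F_CM` at every Hodge failure `(A, p, c)` with `dim A ≤ 2p` (pad `A` by an abelian variety of
# dimension `2p - dim A`, pull `c` back along `fst`, pull the anchor back along `(𝟙, 0)`); hence `F_CM ⟺ F_CM^mid ∧ F_CM^{<mid}` with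
# NO named fact, and the entire possible difference between N104 and N1 sits at failures STRICTLY BELOW the middle (`2 ≤ p`, `2p < dim A`)

research route, not a corollary; conditional on HC_CM plus one named minimal statement.
(Cell line: research route conditional on HC_CM; not a corollary; Q11.4-sentence-2 already refuted in dim ≥ 3.)

Seat `pub-hodge-ring2-ab-spread-1` (SPREADING), generation 51. Nothing in this file is a case of the Hodge conjecture.
`HC_CM` = `Theses.RankFourFaces.CMAbelianHodge` and `HC_AV` = `Theses.PadicSemiregularLift.HodgeAbelianVarieties` do NOT occur in
this file; the item `Theses.RankFourFaces.CMToAbelian` (stmt-HodgeConjecture-16267) stays OPEN. No definition, no new named fact, no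
sorry, no new node. Two shapes are DISPLAYED (`local notation3`, no `def`, nothing enters the census): `F_CM^{≥mid}` / `F_CM^{<mid}` =
part VII's floor `F_CM` (`HodgeFailureSpreadsToCMFibre`, N1) restricted to Hodge failures `(A, p, c)` with `dim A ≤ 2p` / `2p < dim A`.

## Why this file (the record it sharpens, by name)

* Part XXIV (`Ring2AbelianAllSpreadFloorMiddle`, honest column) filed N104 `F_CM^mid` (`MiddleHodgeFailureSpreadsToCMFibre`) with the
  fact-free edge `F_CM ⟹ F_CM^mid` and recorded the converse "OPEN `HC_CM`-free … the pull-back transport of XVII §1 / XXII preserves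
  the degree `2p` and therefore cannot produce the converse edge". PRECISELY: the pull-back transport preserves the DEGREE but not the
  DIMENSION — padding `A ↦ A × B` with `dim B = 2p - dim A` puts `fst^* c` in the MIDDLE degree of a `2p`-fold whenever `dim A ≤ 2p`,
  and part VII's anchored datum compares through an ARBITRARY homomorphism `g : A ⟶ A₁`, so the anchor of `fst^* c` pulls back along
  `(𝟙, 0)` (XVII §1 `IsCMAnchoredDatumFor.comap`). So the converse IS produced by that transport at every failure AT OR ABOVE the
  middle, with no fact (§2); what the transport cannot reach is the half STRICTLY BELOW the middle (for `A` simple of dimension `> 2p`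
  every homomorphism to a `2p`-fold is zero, so no pull-back padding of `c` exists; the Gysin padding `σ_!` of parts XIV/XV reaches the
  middle but is not read back by the datum's pull-back comparison — XIV/XV honest item (i)).
* Part XXVI §3 (`Ring2AbelianAllSpreadFloorHeredity`) recorded the upper-half agreement MODULO Deligne's `hF`
  (`exists_isCMAnchoredDatumFor_of_middle_of_dim_le_of_deligne1982`: CM failure in codimension `p` + part XXV's product-datum engine).
  §2 below is the same conclusion with `hF` REMOVED (direct padding; no engine, no CM failure detour). Part XXVII's `F_CM^mid ⟺ F_CM`
  modulo `[hF ∧ h83]` (Hazama) is untouched: the facts are now needed ONLY strictly below the middle.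
* Part XXXII-b of the ANDRÉ axis (@ab-andre-2, `Ring2AbelianAllAndreProductPencilsNodes`, its l.44–48 / l.216–222) proves on compact
  abelian pencils `(·) ⟺ (·)^mid` fact-free by Gysin padding on product pencils and compares: "on the SPREADING axis only
  `F_CM ⟹ F_CM^mid` holds (spread part XXIV: its families are chosen existentially, and the padded family of `A × B` need not come from
  one through `A`)". READ and answered BY NAME here: at the NODE level that sentence stands (N104 → N1 is open `HC_CM`-free; known mod
  `[hF ∧ h83]`, XXVII); at the INSTANCE level the padded family of `A × B` DOES serve `A` whenever the padding is by PULL-BACK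
  (`dim A ≤ 2p`), because the datum's comparison homomorphism absorbs `(𝟙, 0)` — §2; the obstruction is confined to `2p < dim A` and is
  the read-back of a GYSIN padding, exactly as on their axis the Gysin padding is what product pencils supply. Count once: theirs.

## What is proved (all inside `namespace Summit.HodgeConjecture.HodgeConjecture.Ring2.AbelianAll`; every row K = kernel, NO fact)

* §1 `map_prodLift_id_zero_map_fst` — `(𝟙,0)^* fst^* c = c`; `isRationalClass_isOfHodgeType_not_mem_map_fst` — for a non-algebraic
  rational `(p,p)` class `c` on `A`, `fst^* c` on `A × B` is rational, `(p,p)` and non-algebraic (XVII §1 `not_mem_algebraicClasses_of_map_eq`).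
* §2 `exists_isCMAnchoredDatumFor_of_middle_of_dim_le (h : F_CM^mid) (h2p : dim A ≤ 2p) … : ∃ datum anchored at (A, p, c) with a CM
  failure` — THE row of this file.
* §3 `aboveMiddleFloor_of_middle`, `middle_of_aboveMiddleFloor`, `middle_iff_aboveMiddleFloor : F_CM^mid ↔ F_CM^{≥mid}`;
  `belowMiddleFloor_of_hodgeFailureSpreadsToCMFibre : F_CM → F_CM^{<mid}`; `hodgeFailureSpreadsToCMFibre_of_middle_of_belowMiddleFloor :
  F_CM^mid → F_CM^{<mid} → F_CM`; `hodgeFailureSpreadsToCMFibre_iff_middle_and_belowMiddleFloor : F_CM ↔ F_CM^mid ∧ F_CM^{<mid}`;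
  `exists_belowMiddle_failure_of_middle_of_not_floor : F_CM^mid → ¬F_CM → ∃ (A, p, c), 2 ≤ p ∧ 2p < dim A ∧ … ∧ no anchored datum with a
  CM failure` (SEPARATION LOCUS, fact-free form of XXVI's `codim_two_and_not_HC_CM_of_middle_of_not_floor_of_deligne1982`).

## Honest column

Nothing here proves `HC_AV`, `HC_CM`, `CMToAbelian`, `F_CM` or `F_CM^mid`; no case of the Hodge conjecture is proved. The converse
`F_CM^mid → F_CM` is NOT proved and NOT claimed: it is proved on the half `dim A ≤ 2p` (§2) and remains OPEN `HC_CM`-free on the half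
`2p < dim A` (known modulo `[hF ∧ h83]`, part XXVII; no separating model is known or claimed — XXVI/XXVII place any such model in
`HC_CM⁽2⁾ ∧ ¬HC_CM`, and now, fact-free, at a failure strictly below the middle). CENSUS: no node, no `def`, no edge between nodes is
added (`F_CM^{≥mid}`, `F_CM^{<mid}` are displayed binders, never asserted, not `B_min` candidates); the census of record sees N1 → N104
(XXIV) as before. **`B_min` of record UNCHANGED** (N104 `MiddleHodgeFailureSpreadsToCMFibre`, exact `HC_AV ↔ HC_CM ∧ F_CM^mid`);
"minimal" is claimed for nothing; "strictly smaller than `F_CM`" is claimed for nothing. Only `N⁰H⁰ = ⊤` (`algebraicClasses_zero`) and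
Lefschetz `(1,1)` (tree theorem `lefschetzOneOne_rational_holds`, via XXVI's `forall_codim_AV_one`; counted once, not this axis's) are
used to exclude `p ≤ 1`. Parts VII, XIV–XXVII untouched.
[cite: VoisinHodgeI2002, §7.3.2 and Thm. 11.30] [cite: BrosnanFangNiePearlstein2009, §6 Lemma 48 (proof)] [cite: HatcherAT2002, §3.1]
[cite: Deligne1982HodgeCycles, Prop. 6.1 (a)(b) (p. 71)] [cite: Andre1996Motifs, §1.3 (p. 12)]
-/

noncomputable section

set_option linter.dupNamespace false

open CategoryTheory AlgebraicGeometry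
open Literature.AlgebraicGeometry Literature.AlgebraicGeometry.Motives
open Literature.AlgebraicGeometry.HodgeTheory
open Literature.AlgebraicTopology.SingularHomology
open Literature.AlgebraicGeometry.Deligne1982 (cmLocus)

namespace Summit.HodgeConjecture.HodgeConjecture.Ring2.AbelianAll

open Summit.HodgeConjecture.HodgeConjecture
open Summit.HodgeConjecture.HodgeConjecture.Theorems

variable {𝒳 S : SchemeOver ℂ}

/-- `F_CM^{≥mid}` — DISPLAY ONLY (no `def`, no node, never asserted): part VII's floor `F_CM` restricted to Hodge failures AT OR
ABOVE the middle (`dim A ≤ 2p`). -/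
local notation3 (prettyPrint := false) "AboveMiddleFloor[]" =>
  ∀ (A : AbelianVariety ℂ), IsSmoothProjective A.dim A.X →
    ∀ (p : ℕ) (c : complexBetti A.X (2 * p)), A.dim ≤ 2 * p → IsRationalClass c → IsOfHodgeType A.dim A.X (2 * p) p p c →
      c ∉ algebraicClasses A.X p →
        ∃ (n : ℕ) (𝒳 S : SchemeOver ℂ) (f : 𝒳 ⟶ S) (s : ComplexPoints S) (W : complexBetti 𝒳 (2 * p)),
          IsCMAnchoredDatumFor A p c f n s W ∧
            ∃ s' ∈ cmLocus f n, complexBetti.map (fiberι f s') (2 * p) W ∉ algebraicClasses (fiberOver f s') p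

/-- `F_CM^{<mid}` — DISPLAY ONLY (no `def`, no node, never asserted): part VII's floor `F_CM` restricted to Hodge failures STRICTLY
BELOW the middle (`2p < dim A`). -/
local notation3 (prettyPrint := false) "BelowMiddleFloor[]" =>
  ∀ (A : AbelianVariety ℂ), IsSmoothProjective A.dim A.X →
    ∀ (p : ℕ) (c : complexBetti A.X (2 * p)), 2 * p < A.dim → IsRationalClass c → IsOfHodgeType A.dim A.X (2 * p) p p c →
      c ∉ algebraicClasses A.X p →
        ∃ (n : ℕ) (𝒳 S : SchemeOver ℂ) (f : 𝒳 ⟶ S) (s : ComplexPoints S) (W : complexBetti 𝒳 (2 * p)),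
          IsCMAnchoredDatumFor A p c f n s W ∧
            ∃ s' ∈ cmLocus f n, complexBetti.map (fiberι f s') (2 * p) W ∉ algebraicClasses (fiberOver f s') p

/-! ## §1 Padding by pull-back along the first projection (fact-free) -/

/-- The slice homomorphism `(𝟙, 0) : A ⟶ A × B` splits the first projection on cohomology: `(𝟙,0)^* (fst^* c) = c` on
`Hᵏ(A(ℂ); ℂ)` (`(𝟙,0) ≫ fst = 𝟙`, functoriality). NO fact. [cite: FultonYoungTableaux1997, Appendix B §B.1 (1)] -/
theorem map_prodLift_id_zero_map_fst (A B : AbelianVariety ℂ) (k : ℕ) (c : complexBetti A.X k) :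
    complexBetti.map (AbelianVariety.prodLift (𝟙 A) (0 : A ⟶ B)).hom.hom.hom k
        (complexBetti.map (AbelianVariety.fst A B).hom.hom.hom k c) = c := by
  rw [← complexBetti.map_comp_apply']
  have hcomp : (AbelianVariety.prodLift (𝟙 A) (0 : A ⟶ B)).hom.hom.hom ≫ (AbelianVariety.fst A B).hom.hom.hom =
      (AbelianVariety.prodLift (𝟙 A) (0 : A ⟶ B) ≫ AbelianVariety.fst A B).hom.hom.hom := rfl
  rw [hcomp, AbelianVariety.prodLift_fst]
  change complexBetti.map (𝟙 A.X) k c = c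
  rw [complexBetti.map_id]
  rfl

/-- **The padded class.** For a rational `(p,p)` class `c ∈ H²ᵖ(A(ℂ); ℂ)` that is NOT algebraic and any abelian variety `B`, the
pull-back `fst^* c` to `A × B` is rational, of type `(p,p)` (pull-back along a morphism of smooth projective varieties) and NOT
algebraic (it restricts to `c` along `(𝟙, 0)`: part XVII §1 `not_mem_algebraicClasses_of_map_eq`). NO fact.
[cite: VoisinHodgeI2002, §7.3.2] [cite: HatcherAT2002, §3.1] -/
theorem isRationalClass_isOfHodgeType_not_mem_map_fst (A B : AbelianVariety ℂ) {p : ℕ} {c : complexBetti A.X (2 * p)}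
    (hc : IsRationalClass c) (hpp : IsOfHodgeType A.dim A.X (2 * p) p p c) (hnc : c ∉ algebraicClasses A.X p) :
    IsRationalClass (complexBetti.map (AbelianVariety.fst A B).hom.hom.hom (2 * p) c) ∧
      IsOfHodgeType (A.prod B).dim (A.prod B).X (2 * p) p p (complexBetti.map (AbelianVariety.fst A B).hom.hom.hom (2 * p) c) ∧
        complexBetti.map (AbelianVariety.fst A B).hom.hom.hom (2 * p) c ∉ algebraicClasses (A.prod B).X p :=
  ⟨hc.pullback _,
    hpp.map_of_isSmoothProjective AbelianVariety.isSmoothProjective_holds AbelianVariety.isSmoothProjective_holds _,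
    not_mem_algebraicClasses_of_map_eq (AbelianVariety.prodLift (𝟙 A) (0 : A ⟶ B)) (map_prodLift_id_zero_map_fst A B _ c) hnc⟩

/-! ## §2 `F_CM^mid` yields the full instance of `F_CM` at every failure at or above the middle — NO fact -/

/-- **`F_CM^mid` gives the FULL instance of `F_CM` at every Hodge failure `(A, p, c)` AT OR ABOVE the middle (`dim A ≤ 2p`) — NO
fact** (part XXVI's `exists_isCMAnchoredDatumFor_of_middle_of_dim_le_of_deligne1982` with Deligne's `hF` REMOVED). Pad `A` by an
abelian variety `B` of dimension `2p - dim A` (`exists_abelianVariety_dim_eq_succ`; no padding if `dim A = 2p`): `fst^* c` is a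
non-algebraic rational `(p,p)` class in the MIDDLE degree of the `2p`-fold `A × B` (§1); `F_CM^mid` anchors it with a CM failure; the
anchor pulls back along `(𝟙, 0) : A ⟶ A × B` (part XVII §1 `IsCMAnchoredDatumFor.comap`: the comparison homomorphism `g` becomes
`(𝟙,0) ≫ g`), with the SAME family, CM point, global class and failing CM fibre. `p ≤ 1` carries no failure (`N⁰H⁰ = ⊤`; Lefschetz
`(1,1)` = tree theorem, via XXVI's `forall_codim_AV_one`). [cite: VoisinHodgeI2002, §7.3.2 and Thm. 11.30]
[cite: BrosnanFangNiePearlstein2009, §6 Lemma 48 (proof)] -/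
theorem exists_isCMAnchoredDatumFor_of_middle_of_dim_le (h : MiddleHodgeFailureSpreadsToCMFibre) {A : AbelianVariety ℂ} {p : ℕ}
    (h2p : A.dim ≤ 2 * p) {c : complexBetti A.X (2 * p)} (hc : IsRationalClass c)
    (hpp : IsOfHodgeType A.dim A.X (2 * p) p p c) (hnc : c ∉ algebraicClasses A.X p) :
    ∃ (n : ℕ) (𝒳 S : SchemeOver ℂ) (f : 𝒳 ⟶ S) (s : ComplexPoints S) (W : complexBetti 𝒳 (2 * p)),
      IsCMAnchoredDatumFor A p c f n s W ∧
        ∃ s' ∈ cmLocus f n, complexBetti.map (fiberι f s') (2 * p) W ∉ algebraicClasses (fiberOver f s') p := by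
  have hp : 2 ≤ p := by
    by_contra hlt
    push Not at hlt
    interval_cases p
    · exact hnc (forall_codim_AV_zero A c hc hpp)
    · exact hnc (forall_codim_AV_one A c hc hpp)
  obtain ⟨r, hr⟩ : ∃ r, 2 * p = A.dim + r := ⟨2 * p - A.dim, by omega⟩
  rcases r with _ | r'
  · exact h A AbelianVariety.isSmoothProjective_holds p hp (by omega) c hc hpp hnc
  · obtain ⟨B, hB⟩ := exists_abelianVariety_dim_eq_succ ℂ r'
    have hdim : (A.prod B).dim = 2 * p := by rw [AbelianVariety.dim_prod, hB]; omega
    obtain ⟨hc', hpp', hnc'⟩ := isRationalClass_isOfHodgeType_not_mem_map_fst A B hc hpp hnc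
    obtain ⟨n, 𝒳, S, f, s, W, hdat, hfail⟩ :=
      h (A.prod B) AbelianVariety.isSmoothProjective_holds p hp hdim _ hc' hpp' hnc'
    exact ⟨n, 𝒳, S, f, s, W, hdat.comap _ (map_prodLift_id_zero_map_fst A B _ c), hfail⟩

/-! ## §3 Rows: `F_CM^mid ⟺ F_CM^{≥mid}`; `F_CM ⟺ F_CM^mid ∧ F_CM^{<mid}`; the separation locus — all fact-free -/

/-- **`F_CM^mid ⟹ F_CM^{≥mid}`**, NO fact (§2). [folklore] -/
theorem aboveMiddleFloor_of_middle (h : MiddleHodgeFailureSpreadsToCMFibre) : AboveMiddleFloor[] :=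
  fun _ _ _ _ h2p hc hpp hnc ↦ exists_isCMAnchoredDatumFor_of_middle_of_dim_le h h2p hc hpp hnc

/-- **`F_CM^{≥mid} ⟹ F_CM^mid`**, NO fact: a middle failure is a failure at or above the middle. [folklore] -/
theorem middle_of_aboveMiddleFloor (h : AboveMiddleFloor[]) : MiddleHodgeFailureSpreadsToCMFibre :=
  fun A hA m _ hdim c hc hpp hnc ↦ h A hA m c (by omega) hc hpp hnc

/-- **`F_CM^mid ⟺ F_CM^{≥mid}`**, NO fact: census node N104 IS the floor restricted to failures at or above the middle (a change of
BINDER, not of strength, on that half). [folklore] -/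
theorem middle_iff_aboveMiddleFloor : MiddleHodgeFailureSpreadsToCMFibre ↔ AboveMiddleFloor[] :=
  ⟨aboveMiddleFloor_of_middle, middle_of_aboveMiddleFloor⟩

/-- **`F_CM ⟹ F_CM^{<mid}`**, NO fact (restriction). [folklore] -/
theorem belowMiddleFloor_of_hodgeFailureSpreadsToCMFibre (h : HodgeFailureSpreadsToCMFibre) : BelowMiddleFloor[] :=
  fun A hA p c _ hc hpp hnc ↦ h A hA p c hc hpp hnc

/-- **`F_CM^mid → F_CM^{<mid} → F_CM`**, NO fact: at or above the middle by §2, strictly below by the displayed hypothesis. [folklore] -/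
theorem hodgeFailureSpreadsToCMFibre_of_middle_of_belowMiddleFloor (h : MiddleHodgeFailureSpreadsToCMFibre)
    (hb : BelowMiddleFloor[]) : HodgeFailureSpreadsToCMFibre := by
  intro A hA p c hc hpp hnc
  rcases Nat.lt_or_ge (2 * p) A.dim with hlt | hge
  · exact hb A hA p c hlt hc hpp hnc
  · exact exists_isCMAnchoredDatumFor_of_middle_of_dim_le h hge hc hpp hnc

/-- **`F_CM ⟺ F_CM^mid ∧ F_CM^{<mid}`**, NO fact: N1 is N104 together with the floor strictly below the middle — the ENTIRE possible
difference between N104 and N1 sits at Hodge failures `(A, p, c)` with `2 ≤ p` and `2p < dim A`. [folklore] -/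
theorem hodgeFailureSpreadsToCMFibre_iff_middle_and_belowMiddleFloor :
    HodgeFailureSpreadsToCMFibre ↔ MiddleHodgeFailureSpreadsToCMFibre ∧ BelowMiddleFloor[] :=
  ⟨fun h ↦ ⟨middleHodgeFailureSpreadsToCMFibre_of_hodgeFailureSpreadsToCMFibre h,
      belowMiddleFloor_of_hodgeFailureSpreadsToCMFibre h⟩,
    fun h ↦ hodgeFailureSpreadsToCMFibre_of_middle_of_belowMiddleFloor h.1 h.2⟩

/-- **SEPARATION LOCUS, fact-free form**: a model of `F_CM^mid ∧ ¬F_CM` contains a Hodge failure `(A, p, c)` STRICTLY BELOW the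
middle (`2 ≤ p`, `2p < dim A`) that admits NO CM-pointed anchored datum with a CM failure. (Part XXVI placed the difference below the
middle modulo `hF`; here NO fact. No such model is known or claimed.) [folklore] -/
theorem exists_belowMiddle_failure_of_middle_of_not_floor (h : MiddleHodgeFailureSpreadsToCMFibre)
    (hn : ¬ HodgeFailureSpreadsToCMFibre) :
    ∃ (A : AbelianVariety ℂ) (p : ℕ) (c : complexBetti A.X (2 * p)), 2 ≤ p ∧ 2 * p < A.dim ∧ IsRationalClass c ∧
      IsOfHodgeType A.dim A.X (2 * p) p p c ∧ c ∉ algebraicClasses A.X p ∧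
        ¬ ∃ (n : ℕ) (𝒳 S : SchemeOver ℂ) (f : 𝒳 ⟶ S) (s : ComplexPoints S) (W : complexBetti 𝒳 (2 * p)),
          IsCMAnchoredDatumFor A p c f n s W ∧
            ∃ s' ∈ cmLocus f n, complexBetti.map (fiberι f s') (2 * p) W ∉ algebraicClasses (fiberOver f s') p := by
  by_contra hcon
  push Not at hcon
  refine hn (hodgeFailureSpreadsToCMFibre_of_middle_of_belowMiddleFloor h fun A hA p c hlt hc hpp hnc ↦ ?_)
  have hp : 2 ≤ p := by
    by_contra hlt'
    push Not at hlt'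
    interval_cases p
    · exact absurd (forall_codim_AV_zero A c hc hpp) hnc
    · exact absurd (forall_codim_AV_one A c hc hpp) hnc
  exact hcon A p c hp hlt hc hpp hnc

end Summit.HodgeConjecture.HodgeConjecture.Ring2.AbelianAll

end
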